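import Mathlib
import Literature.Probability.Percolation.SmoothedWhiteNoise
import Summits.CriticalPhenomena.CardyFormulaZ2.Theorems.CardyWhiteToColouredNoiseDiscretisation
import Summits.CriticalPhenomena.CardyFormulaZ2.Theorems.CardyWhiteToColouredNoiseDiscretisationSignMeasurable
import Summits.CriticalPhenomena.CardyFormulaZ2.Theorems.CardyWhiteToColouredDriftBoundStubWhiteWindow

/-!
# The two open windows of line `registered` are crux-sized: what each implies

Helper file for the crux item `stmt-CriticalPhenomena-4596`
(`Summit.CriticalPhenomena.CardyFormulaZ2.Theses.CardyWhiteToColoured.DriftBound`, route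
`CardyWhiteToColoured` of `CardyFormulaZ2`), line `registered` (`Cruxes/DriftBound/Lines/birth.lean`,
skeleton v3, lead c2). No new statement is claimed; these are kernel-checked consequences that size
the two remaining (open) window stubs, plus the scaling identity that places the crux's lattice
term `P^latt_{s,δ}(R)` on the one-parameter family `signConfigLaw σ 1`, `σ = s/δ`, for which uniform
RSW is proved in `Theorems/CardyWhiteToColouredDriftBoundUniformRSW.lean`.

* `smoothedNoise_medialPoint_scale`, `signConfig_scale`, `signConfigLaw_scale`,
  `smoothedCrossingProb_eq_signConfigLaw_div` — for `δ ≠ 0`,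
  `signConfig s δ = signConfig (s/δ) 1` (the medial points scale, `m_δ = δ m_1`, and the Gaussian
  weight only sees `|m_δ e − m_δ e'|/s`), hence
  `P^latt_{s,δ}(Ω; A, B) = (signConfigLaw (s/δ) 1)(discreteCrossing Ω δ A B)`.
* `latticeUniversality_of_crossoverWindow` — the crossover window B2 (v2 form), together with the
  LANDED white window `stub_whiteWindow`, says that for every `M ≥ 1` and every conformal rectangle
  the crossing probabilities of `R_δ` under the lattice model `σ = M` and under critical bond
  percolation merge as `δ → 0⁺`: crossing-probability universality between two distinct planar
  lattice models (open-problem class).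
* `continuumLimit_of_smoothWindow` — the smooth window C (v2 form) ALONE implies, through the
  proved fixed-width discretisation `WhiteToColoured.tendsto_smoothedCrossingProb`, that for every
  white noise `μ`, Gaussian bump family `k` and conformal rectangle `R` the continuum crossing
  probabilities `P^cont_ℓ(R)` converge as the width `ℓ → 0⁺` — by the similarity covariance of the
  continuum family this is the existence of the large-scale crossing limit of the positive set of
  Gaussian-smoothed planar white noise (a Bargmann–Fock-type field), listed as open in
  Muirhead–Vanneuville 2020 §1.4 / Beliaev 2023 Conj. 6.4. So C is crux-sized on its own.

References: BeliaevMuirheadRivera2020, MuirheadVanneuville2020 §1.4, Beliaev2023 §6, BeffaraGayet2017.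
-/

noncomputable section

namespace Summit.CriticalPhenomena.CardyFormulaZ2.Cruxes.DriftBound.Birth

open Set Filter Topology MeasureTheory
open Literature.Probability.LatticeModels Literature.Probability.Percolation
open Literature.Probability.RandomPlanarGeometry
open Summit.CriticalPhenomena.CardyFormulaZ2.Theorems.WhiteToColoured

/-! ### Scaling: only `σ = s/δ` matters for the sign configuration -/

/-- Medial points scale with the mesh: `m_δ(e) = δ · m_1(e)`. -/
theorem medialPoint_eq_mul_medialPoint_one (δ : ℝ) (e : Sym2 (Site 2)) :
    medialPoint δ e = (δ : ℂ) * medialPoint 1 e := by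
  induction e using Sym2.ind with
  | h x y => simp [medialPoint_mk, meshPoint]; ring

/-- **Scaling of the smoothed noise at medial points**: for `δ ≠ 0`, the field of width `s` at
mesh `δ` read at `m_δ(e)` equals the field of width `s/δ` at mesh `1` read at `m_1(e)` (termwise:
`|m_δ e − m_δ e'|²/(2s²) = |m_1 e − m_1 e'|²/(2(s/δ)²)`; no summability is needed). -/
theorem smoothedNoise_medialPoint_scale {s δ : ℝ} (hδ : δ ≠ 0) (ξ : (zdGraph 2).edgeSet → ℝ)
    (e : Sym2 (Site 2)) :
    smoothedNoise s δ ξ (medialPoint δ e) = smoothedNoise (s / δ) 1 ξ (medialPoint 1 e) := by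
  unfold smoothedNoise
  refine tsum_congr fun e' => ?_
  congr 2
  rw [medialPoint_eq_mul_medialPoint_one δ e, medialPoint_eq_mul_medialPoint_one δ e'.1,
    ← mul_sub, norm_mul, Complex.norm_real, Real.norm_eq_abs, mul_pow, sq_abs]
  field_simp

/-- **Scaling of the sign configuration**: `signConfig s δ = signConfig (s/δ) 1` for `δ ≠ 0`. -/
theorem signConfig_scale {s δ : ℝ} (hδ : δ ≠ 0) : signConfig s δ = signConfig (s / δ) 1 := by
  funext ξ
  ext e
  rw [mem_signConfig_iff, mem_signConfig_iff, smoothedNoise_medialPoint_scale hδ]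

/-- **Scaling of the sign law**: `signConfigLaw s δ = signConfigLaw (s/δ) 1` for `δ ≠ 0` — the
crux's lattice models at mesh `δ` and width `s` form the one-parameter family `σ = s/δ`. -/
theorem signConfigLaw_scale {s δ : ℝ} (hδ : δ ≠ 0) : signConfigLaw s δ = signConfigLaw (s / δ) 1 := by
  rw [signConfigLaw, signConfigLaw, signConfig_scale hδ]

/-- **The crux's lattice term on the `σ`-family**: for `δ ≠ 0`,
`P^latt_{s,δ}(Ω; A, B) = (signConfigLaw (s/δ) 1)(discreteCrossing Ω δ A B)` — the crossing
probability of the discrete domain `Ω_δ` under the lattice sign model of width `σ = s/δ` lattice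
spacings (the family for which uniform RSW is proved). -/
theorem smoothedCrossingProb_eq_signConfigLaw_div :
    ∀ s δ : ℝ, δ ≠ 0 → ∀ Ω A B : Set ℂ,
      Literature.Probability.Percolation.smoothedCrossingProb s δ Ω A B =
        (Literature.Probability.Percolation.signConfigLaw (s / δ) 1).real
          (Literature.Probability.Percolation.discreteCrossing Ω δ A B) := by
  intro s δ hδ Ω A B
  rw [smoothedCrossingProb_eq_signConfigLaw, signConfigLaw_scale hδ]

/-! ### B2 + B1: universality between the `σ = M` lattice model and bond percolation -/

/-- **The crossover window is a two-model universality statement.** If the crossover window B2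
holds (v2 form: for every `M ≥ 1`, `ε > 0`, eventually in `δ`, `|P(Mδ) − P(s)| < ε` for all
`s ∈ [δ/(1+|log δ|), Mδ]`), then — with the landed white window `stub_whiteWindow` at the cut
`s⋆ = δ/(1+|log δ|)` — for every `M ≥ 1` and every conformal rectangle `R` the crossing
probabilities of `R_δ` under the width-`M` lattice sign model and under critical bond percolation
on `ℤ²` merge as `δ → 0⁺`. -/
theorem latticeUniversality_of_crossoverWindow
    (hB2 : ∀ R : Literature.Probability.RandomPlanarGeometry.ConformalRectangle, ∀ M : ℝ, 1 ≤ M →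
      ∀ ε : ℝ, 0 < ε → ∃ δ₀ : ℝ, 0 < δ₀ ∧ ∀ δ : ℝ, 0 < δ → δ < δ₀ →
        ∀ s : ℝ, δ / (1 + |Real.log δ|) ≤ s → s ≤ M * δ →
          |Literature.Probability.Percolation.smoothedCrossingProb (M * δ) δ R.carrier (R.arc 0) (R.arc 2)
            - Literature.Probability.Percolation.smoothedCrossingProb s δ R.carrier (R.arc 0) (R.arc 2)| < ε)
    (R : Literature.Probability.RandomPlanarGeometry.ConformalRectangle) {M : ℝ} (hM : 1 ≤ M) :
    Tendsto (fun δ => Literature.Probability.Percolation.smoothedCrossingProb (M * δ) δ R.carrier (R.arc 0) (R.arc 2)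
        - Literature.Probability.Percolation.bondDomainCrossingProb R δ) (𝓝[>] 0) (𝓝 0) := by
  rw [Metric.tendsto_nhdsWithin_nhds]
  intro ε hε
  obtain ⟨δ₂, hδ₂, h2⟩ := hB2 R M hM (ε / 2) (half_pos hε)
  obtain ⟨δ₁, hδ₁, h1⟩ := stub_whiteWindow R (ε / 2) (half_pos hε)
  refine ⟨min δ₁ δ₂, lt_min hδ₁ hδ₂, fun {δ} hδ hδd => ?_⟩
  have hδpos : 0 < δ := hδ
  have hδlt : δ < min δ₁ δ₂ := by simpa [Real.dist_eq, abs_of_pos hδpos] using hδd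
  have h1le : (1 : ℝ) ≤ 1 + |Real.log δ| := le_add_of_nonneg_right (abs_nonneg _)
  have hspos : 0 < δ / (1 + |Real.log δ|) := div_pos hδpos (one_pos.trans_le h1le)
  have hsle : δ / (1 + |Real.log δ|) ≤ δ := div_le_self hδpos.le h1le
  have hsM : δ / (1 + |Real.log δ|) ≤ M * δ := hsle.trans (by nlinarith)
  have hA := h2 δ hδpos (lt_of_lt_of_le hδlt (min_le_right _ _)) _ le_rfl hsM
  have hB := h1 δ hδpos (lt_of_lt_of_le hδlt (min_le_left _ _)) _ hspos le_rfl
  rw [Real.dist_eq, sub_zero]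
  calc |smoothedCrossingProb (M * δ) δ R.carrier (R.arc 0) (R.arc 2) - bondDomainCrossingProb R δ|
      ≤ |smoothedCrossingProb (M * δ) δ R.carrier (R.arc 0) (R.arc 2)
            - smoothedCrossingProb (δ / (1 + |Real.log δ|)) δ R.carrier (R.arc 0) (R.arc 2)|
        + |smoothedCrossingProb (δ / (1 + |Real.log δ|)) δ R.carrier (R.arc 0) (R.arc 2)
            - bondDomainCrossingProb R δ| := abs_sub_le _ _ _
    _ < ε / 2 + ε / 2 := add_lt_add hA hB
    _ = ε := by ring

/-! ### C alone: the continuum crossing probabilities converge as the width tends to `0` -/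

/-- **The smooth window alone gives the continuum scaling limit.** If the smooth window C holds
(v2 form: for some `M ≥ 1`, `∀ ε ∃ ℓ₀ ∀ ℓ < ℓ₀ ∃ δ₀ ∀ δ < δ₀ ∀ s ∈ [Mδ, ℓ]`, `|P(ℓ) − P(s)| < ε`),
then for every white noise `μ` on `ℂ`, every Gaussian bump family `k` and every conformal rectangle
`R`, the continuum crossing probabilities `ℓ ↦ P^cont_ℓ(R) = continuumCrossingProb μ k ℓ R` converge
as `ℓ → 0⁺`: letting `δ → 0⁺` in C at fixed `0 < s ≤ ℓ < ℓ₀` through the fixed-width discretisation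
theorem `tendsto_smoothedCrossingProb` gives `|P^cont_ℓ(R) − P^cont_s(R)| ≤ ε`, i.e. the Cauchy
criterion at `0⁺`. (By `EuclideanCovariance`, `P^cont_ℓ(R) = P^cont_1(ℓ⁻¹ R)`: this is the
existence of the large-scale crossing limit for the positive set of Gaussian-smoothed planar white
noise — open; so C is crux-sized by itself.) -/
theorem continuumLimit_of_smoothWindow
    (hC : ∀ R : Literature.Probability.RandomPlanarGeometry.ConformalRectangle, ∃ M : ℝ, 1 ≤ M ∧
      ∀ ε : ℝ, 0 < ε → ∃ ℓ₀ : ℝ, 0 < ℓ₀ ∧ ∀ ℓ : ℝ, 0 < ℓ → ℓ < ℓ₀ → ∃ δ₀ : ℝ, 0 < δ₀ ∧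
        ∀ δ : ℝ, 0 < δ → δ < δ₀ → ∀ s : ℝ, M * δ ≤ s → s ≤ ℓ →
          |Literature.Probability.Percolation.smoothedCrossingProb ℓ δ R.carrier (R.arc 0) (R.arc 2)
            - Literature.Probability.Percolation.smoothedCrossingProb s δ R.carrier (R.arc 0) (R.arc 2)| < ε)
    {μ : MeasureTheory.Measure (Literature.MathematicalPhysics.QuantumLattice.FieldConfig ℂ)}
    (hμ : Literature.Probability.Percolation.IsWhiteNoise μ)
    {k : ℝ → ℂ → SchwartzMap ℂ ℝ} (hk : Literature.Probability.Percolation.IsGaussianBumpFamily k)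
    (R : Literature.Probability.RandomPlanarGeometry.ConformalRectangle) :
    ∃ Ψ : ℝ, Tendsto (fun ℓ => Literature.Probability.Percolation.continuumCrossingProb μ k ℓ R)
      (𝓝[>] 0) (𝓝 Ψ) := by
  set Q : ℝ → ℝ := fun ℓ => continuumCrossingProb μ k ℓ R with hQ
  obtain ⟨M, hM, hCR⟩ := hC R
  have hMpos : 0 < M := one_pos.trans_le hM
  -- Step 1: `|Q ℓ - Q s| ≤ ε` for `0 < s ≤ ℓ < ℓ₀(ε)`.
  have key : ∀ ε : ℝ, 0 < ε → ∃ ℓ₀ : ℝ, 0 < ℓ₀ ∧ ∀ ℓ s : ℝ, 0 < s → s ≤ ℓ → ℓ < ℓ₀ →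
      |Q ℓ - Q s| ≤ ε := by
    intro ε hε
    obtain ⟨ℓ₀, hℓ₀, H⟩ := hCR ε hε
    refine ⟨ℓ₀, hℓ₀, fun ℓ s hs hsℓ hℓ => ?_⟩
    have hℓpos : 0 < ℓ := hs.trans_le hsℓ
    obtain ⟨δ₀, hδ₀, Hδ⟩ := H ℓ hℓpos hℓ
    -- the difference of the two lattice terms tends to `Q ℓ - Q s` as `δ → 0⁺`
    have ht : Tendsto (fun δ => smoothedCrossingProb ℓ δ R.carrier (R.arc 0) (R.arc 2)
        - smoothedCrossingProb s δ R.carrier (R.arc 0) (R.arc 2)) (𝓝[>] 0) (𝓝 (Q ℓ - Q s)) :=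
      (tendsto_smoothedCrossingProb hμ hk R hℓpos).sub (tendsto_smoothedCrossingProb hμ hk R hs)
    have habs := (continuous_abs.tendsto _).comp ht
    refine le_of_tendsto habs ?_
    -- eventually in `δ → 0⁺`: `δ < δ₀` and `M δ ≤ s`
    have hev : ∀ᶠ δ in 𝓝[>] (0 : ℝ), δ ∈ Ioo 0 (min δ₀ (s / M)) :=
      Ioo_mem_nhdsGT (lt_min hδ₀ (div_pos hs hMpos))
    filter_upwards [hev] with δ hδ
    have hδ0 : δ < δ₀ := lt_of_lt_of_le hδ.2 (min_le_left _ _)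
    have hδs : M * δ ≤ s := by
      have h := lt_of_lt_of_le hδ.2 (min_le_right _ _)
      have := (lt_div_iff₀ hMpos).1 h
      linarith
    exact (Hδ δ hδ.1 hδ0 s hδs hsℓ).le
  -- Step 2: Cauchy criterion along `𝓝[>] 0`.
  have hcauchy : Cauchy (map Q (𝓝[>] (0 : ℝ))) := by
    rw [Metric.cauchy_iff]
    refine ⟨inferInstance, fun ε hε => ?_⟩
    obtain ⟨ℓ₀, hℓ₀, H⟩ := key (ε / 2) (half_pos hε)
    refine ⟨Q '' Ioo 0 ℓ₀, ?_, ?_⟩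
    · exact mem_map.2 (mem_of_superset (Ioo_mem_nhdsGT hℓ₀) (subset_preimage_image _ _))
    · rintro x ⟨ℓ, hℓ, rfl⟩ y ⟨ℓ', hℓ', rfl⟩
      rw [Real.dist_eq]
      rcases le_total ℓ' ℓ with h | h
      · exact (H ℓ ℓ' hℓ'.1 h hℓ.2).trans_lt (half_lt_self hε)
      · rw [abs_sub_comm]
        exact (H ℓ' ℓ hℓ.1 h hℓ'.2).trans_lt (half_lt_self hε)
  exact cauchy_map_iff_exists_tendsto.1 hcauchy

end Summit.CriticalPhenomena.CardyFormulaZ2.Cruxes.DriftBound.Birth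

end
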